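import Summits.AnomalousDissipation.AnomalousDissipation.Theorems.TwohalfdThesis.Negative.TwohalfdThesisFalseOfSubLogStrain

/-!
# The crux `TwoAndHalfD.TwohalfdNeg` (stmt-AnomalousDissipation-0211) holds modulo the named conjecture `SubLogStrain`

Line `log-kantorovich-enstrophy-transfer`, lead c7 — bookkeeping, no new analysis.  Since 2026-08-17 the line's
residual S6 (`stub_subLogStrain`: bounded-mean-energy steadily forced planar Leray–Hopf families have sub-logarithmic
`limsup`-mean strain) is an in-tree NAMED CONJECTURE,
`Summit.AnomalousDissipation.AnomalousDissipation.Theorems.TwohalfdThesis.Negative.SubLogStrain` (p135209, `@[conjecture]`),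
modulo which the sibling crux `TwohalfdThesis` (stmt-AnomalousDissipation-0206) is refuted
(`TwohalfdThesis_false_of_SubLogStrain`).  This file records the POSITIVE counterpart on this item, by name: the crux
`TwohalfdNeg` is PROVED modulo the same conjecture — the line's transfer certificate
`Certificate.twohalfdNeg_of_subLogStrain` (p120228; composition of the landed stubs S1', S2, S3', S4, S5') read on the
named `def`.  So items 0211 and 0206 are settled in opposite directions by ONE open two-dimensional statement, and
0211's unconditional sub-regions (single shell, `g = 0`, `h = 0`, co-scalar, sub-log-strain families, steady and
regular condensates) are exactly the regions where `SubLogStrain` is not needed.  CONDITIONAL result (hypothesis =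
named conjecture); it does not close the item.
-/

namespace Summit.AnomalousDissipation.AnomalousDissipation.Theorems.TwohalfdNeg.RegularCondensate

open Summit.AnomalousDissipation.AnomalousDissipation.Theorems.TwohalfdThesis

set_option linter.dupNamespace false

/-- **`TwohalfdNeg` modulo `SubLogStrain`.** If the planar sub-log strain conjecture
`TwohalfdThesis.Negative.SubLogStrain` holds, then the crux `TwoAndHalfD.TwohalfdNeg` holds: every bounded-energy
`x₃`-invariant global Leray–Hopf family under an `x₃`-invariant steady smooth divergence-free mean-zero force has
`meanDissipation → 0`.  The transfer certificate `Certificate.twohalfdNeg_of_subLogStrain` of the line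
`log-kantorovich-enstrophy-transfer`, restated on the named conjecture (conditional result). [folklore] -/
theorem twohalfdNeg_of_SubLogStrainConjecture (hS6 : Negative.SubLogStrain) :
    Summit.AnomalousDissipation.AnomalousDissipation.Theses.TwoAndHalfD.TwohalfdNeg :=
  Certificate.twohalfdNeg_of_subLogStrain hS6

/-- **The two cruxes of route `TwoAndHalfD` are decided in opposite directions by `SubLogStrain`.**
`SubLogStrain → (TwohalfdNeg ∧ ¬ TwohalfdThesis)`. [folklore] -/
theorem twohalfdNeg_and_not_twohalfdThesis_of_SubLogStrainConjecture (hS6 : Negative.SubLogStrain) :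
    Summit.AnomalousDissipation.AnomalousDissipation.Theses.TwoAndHalfD.TwohalfdNeg ∧
      ¬ Summit.AnomalousDissipation.AnomalousDissipation.Theses.TwoAndHalfD.TwohalfdThesis :=
  ⟨twohalfdNeg_of_SubLogStrainConjecture hS6, Negative.TwohalfdThesis_false_of_SubLogStrain hS6⟩

/-- **Registered bookkeeping stub `stub_rcConditionalClosure`**: `SubLogStrain → TwohalfdNeg ∧ ¬TwohalfdThesis`
(CONDITIONAL on the named conjecture; does not close either item). [folklore] -/
theorem stub_rcConditionalClosure :
    Summit.AnomalousDissipation.AnomalousDissipation.Theorems.TwohalfdThesis.Negative.SubLogStrain →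
      Summit.AnomalousDissipation.AnomalousDissipation.Theses.TwoAndHalfD.TwohalfdNeg ∧
        ¬ Summit.AnomalousDissipation.AnomalousDissipation.Theses.TwoAndHalfD.TwohalfdThesis :=
  twohalfdNeg_and_not_twohalfdThesis_of_SubLogStrainConjecture

end Summit.AnomalousDissipation.AnomalousDissipation.Theorems.TwohalfdNeg.RegularCondensate
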